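import Mathlib.MeasureTheory.Function.Jacobian
import Mathlib.Analysis.Calculus.ContDiff.RCLike
import Mathlib.Analysis.Calculus.InverseFunctionTheorem.ContDiff
import Mathlib.Analysis.Normed.Module.HahnBanach
import Mathlib.MeasureTheory.Measure.Haar.Unique
import Mathlib.MeasureTheory.Measure.Lebesgue.EqHaar
import Mathlib.Topology.Compactness.SigmaCompact
import HarnessLib

/-!
# Sard's theorem — preliminaries for the proof

Topic `Literature/Analysis/Calculus`. Auxiliary results used in the proof of Sard's theorem
(`Literature.Analysis.Calculus.sard_holds`, file `SardProofs.lean`), following the inductive proof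
of Milnor, *Topology from the Differentiable Viewpoint* (1965), §3 (after Sard 1942 and
Pontryagin): splitting a finite-dimensional space along a nonzero functional, closedness of the
set of non-surjective linear maps, measurability (σ-compactness) of images of relatively closed
subsets of open sets, a "locally null image ⇒ null image" reduction, transport of null sets between
additive Haar measures, the local chart straightening one smooth coordinate (inverse function
theorem), and the flat Taylor estimate `f(y) - f(x) = o(‖y - x‖ᵏ)` at a point where all derivatives
of orders `1, …, k` vanish.

All statements here are standard; they are stated for real finite-dimensional normed spaces.

## References

* J. Milnor, *Topology from the Differentiable Viewpoint* (1965), §3. [MilnorTDV1965]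
* A. Sard, *The measure of the critical values of differentiable maps*, Bull. AMS 48 (1942),
  883–890, §§3–7. [Sard1942]
-/

open MeasureTheory Set Function Filter Metric
open scoped ContDiff Topology NNReal ENNReal

noncomputable section

namespace Literature.Analysis.Calculus.Sard

universe u v

/-! ### Splitting a space along a nonzero functional -/

/-- Given a continuous linear functional `ℓ ≠ 0` on a real normed space `E`, there is a continuous
linear isomorphism `E ≃L ℝ × ker ℓ` whose first component is `ℓ` (namely
`x ↦ (ℓ x, x - ℓ x • v)` for any `v` with `ℓ v = 1`). [folklore] -/
theorem exists_equiv_prod_ker_fst_eq {E : Type u} [NormedAddCommGroup E] [NormedSpace ℝ E]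
    (ℓ : E →L[ℝ] ℝ) (hℓ : ℓ ≠ 0) :
    ∃ Φ : E ≃L[ℝ] ℝ × ℓ.ker, ∀ x, (Φ x).1 = ℓ x := by
  obtain ⟨v₀, hv₀⟩ : ∃ v, ℓ v ≠ 0 := by
    by_contra h
    push Not at h
    exact hℓ (ContinuousLinearMap.ext h)
  set v : E := (ℓ v₀)⁻¹ • v₀ with hv_def
  have hv : ℓ v = 1 := by
    rw [hv_def, map_smul, smul_eq_mul, inv_mul_cancel₀ hv₀]
  have hmem : ∀ x, (ContinuousLinearMap.id ℝ E - ℓ.smulRight v) x ∈ ℓ.ker := by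
    intro x
    simp [hv]
  let A : E →L[ℝ] ℝ × ℓ.ker :=
    ℓ.prod ((ContinuousLinearMap.id ℝ E - ℓ.smulRight v).codRestrict ℓ.ker hmem)
  let B : ℝ × ℓ.ker →L[ℝ] E :=
    ℓ.ker.subtypeL.comp (ContinuousLinearMap.snd ℝ ℝ ℓ.ker) +
      (ContinuousLinearMap.fst ℝ ℝ ℓ.ker).smulRight v
  have hAB : ∀ x, B (A x) = x := by
    intro x
    simp [A, B]
  have hBA : ∀ p, A (B p) = p := by
    rintro ⟨t, y, hy⟩
    have hy' : ℓ y = 0 := hy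
    ext <;> simp [A, B, hy', hv]
  exact ⟨ContinuousLinearEquiv.equivOfInverse A B hAB hBA, fun x => rfl⟩

/-- With `Φ : E ≃L ℝ × ker ℓ` as above, `finrank (ker ℓ) + 1 = finrank E`. [folklore] -/
theorem finrank_ker_add_one_eq {E : Type u} [NormedAddCommGroup E] [NormedSpace ℝ E]
    [FiniteDimensional ℝ E] (ℓ : E →L[ℝ] ℝ) (Φ : E ≃L[ℝ] ℝ × ℓ.ker) :
    Module.finrank ℝ ℓ.ker + 1 = Module.finrank ℝ E := by
  have h := Φ.toLinearEquiv.finrank_eq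
  rw [Module.finrank_prod, Module.finrank_self] at h
  omega

/-! ### Non-surjective linear maps form a closed set -/

/-- In finite dimension, the set of non-surjective continuous linear maps `E →L[ℝ] F` is closed
(lower semicontinuity of the rank). [folklore] -/
theorem isClosed_setOf_not_surjective {E : Type u} [NormedAddCommGroup E] [NormedSpace ℝ E]
    {F : Type v} [NormedAddCommGroup F] [NormedSpace ℝ F] [FiniteDimensional ℝ F] :
    IsClosed {L : E →L[ℝ] F | ¬ Surjective L} := by
  have key : {L : E →L[ℝ] F | ¬ Surjective L} =
      {L : E →L[ℝ] F | ↑(Module.finrank ℝ F) ≤ (L : E →ₗ[ℝ] F).rank}ᶜ := by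
    ext L
    simp only [mem_setOf_eq, mem_compl_iff, not_iff_not]
    constructor
    · intro hL
      have hr : LinearMap.range (L : E →ₗ[ℝ] F) = ⊤ := LinearMap.range_eq_top.2 hL
      rw [LinearMap.rank, hr, rank_top, Module.finrank_eq_rank]
    · intro h
      have h1 : Module.finrank ℝ F ≤ Module.finrank ℝ (LinearMap.range (L : E →ₗ[ℝ] F)) := by
        rw [LinearMap.rank, ← Module.finrank_eq_rank] at h
        exact_mod_cast h
      have hr : LinearMap.range (L : E →ₗ[ℝ] F) = ⊤ :=
        Submodule.eq_top_of_finrank_eq (le_antisymm (Submodule.finrank_le _) h1)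
      exact LinearMap.range_eq_top.1 hr
  rw [key]
  exact (isOpen_setOf_nat_le_rank _).isClosed_compl

/-! ### Measurability of images of relatively closed sets -/

/-- In a proper second-countable space (e.g. a finite-dimensional real normed space), if `U` is open,
`φ` is continuous on `U` and `N` is closed, then `{x ∈ U | φ x ∈ N}` is σ-compact. [folklore] -/
theorem isSigmaCompact_sep_preimage {X : Type u} [MetricSpace X] [ProperSpace X]
    [SecondCountableTopology X] {Y : Type v} [TopologicalSpace Y] {U : Set X} (hU : IsOpen U)
    {φ : X → Y} (hφ : ContinuousOn φ U) {N : Set Y} (hN : IsClosed N) :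
    IsSigmaCompact {x ∈ U | φ x ∈ N} := by
  have hball : ∀ x ∈ U, ∃ r > 0, closedBall x r ⊆ U := fun x hx =>
    nhds_basis_closedBall.mem_iff.1 (hU.mem_nhds hx)
  choose! r hr hrU using hball
  obtain ⟨t, htU, htc, hcover⟩ := TopologicalSpace.countable_cover_nhdsWithin
    (f := fun x => ball x (r x)) (s := U)
    (fun x hx => mem_nhdsWithin_of_mem_nhds (ball_mem_nhds x (hr x hx)))
  have hrepr : {x ∈ U | φ x ∈ N} = ⋃ x ∈ t, closedBall x (r x) ∩ φ ⁻¹' N := by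
    ext y
    simp only [mem_setOf_eq, mem_iUnion, mem_inter_iff, mem_preimage, exists_prop]
    constructor
    · rintro ⟨hyU, hyN⟩
      obtain ⟨x, hxt, hyx⟩ : ∃ x ∈ t, y ∈ ball x (r x) := by
        simpa only [mem_iUnion, exists_prop] using hcover hyU
      exact ⟨x, hxt, ball_subset_closedBall hyx, hyN⟩
    · rintro ⟨x, hxt, hyx, hyN⟩
      exact ⟨hrU x (htU hxt) hyx, hyN⟩
  rw [hrepr]
  refine isSigmaCompact_biUnion htc fun x hxt => IsCompact.isSigmaCompact ?_
  exact (isCompact_closedBall x (r x)).of_isClosed_subset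
    ((hφ.mono (hrU x (htU hxt))).preimage_isClosed_of_isClosed isClosed_closedBall hN)
    inter_subset_left

/-- σ-compact sets are measurable (in a Hausdorff space whose open sets are measurable).
[folklore] -/
theorem measurableSet_of_isSigmaCompact {X : Type u} [TopologicalSpace X] [T2Space X]
    [MeasurableSpace X] [OpensMeasurableSpace X] {s : Set X} (hs : IsSigmaCompact s) :
    MeasurableSet s := by
  obtain ⟨K, hK, rfl⟩ := hs
  exact MeasurableSet.iUnion fun n => (hK n).measurableSet

/-- If `U` is open, `f` and `φ` are continuous on `U` and `N` is closed, then the image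
`f '' {x ∈ U | φ x ∈ N}` is measurable (it is σ-compact). Used with `φ = fderiv ℝ f` and `N` the set
of non-surjective linear maps: the set of critical values on `U` is measurable. [folklore] -/
theorem measurableSet_image_sep_preimage {X : Type u} [MetricSpace X] [ProperSpace X]
    [SecondCountableTopology X] {Y : Type v} [TopologicalSpace Y] {Z : Type*}
    [TopologicalSpace Z] [T2Space Z] [MeasurableSpace Z] [OpensMeasurableSpace Z]
    {U : Set X} (hU : IsOpen U) {f : X → Z} (hf : ContinuousOn f U)
    {φ : X → Y} (hφ : ContinuousOn φ U) {N : Set Y} (hN : IsClosed N) :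
    MeasurableSet (f '' {x ∈ U | φ x ∈ N}) :=
  measurableSet_of_isSigmaCompact ((isSigmaCompact_sep_preimage hU hφ hN).image_of_continuousOn
    (hf.mono fun _ hx => hx.1))

/-! ### Local-to-global and transport of null images -/

/-- If every point of `s` has a neighbourhood `V` with `μ (f '' (s ∩ V)) = 0`, then `μ (f '' s) = 0`
(second countability). [folklore] -/
theorem measure_image_null_of_locally {X : Type u} [TopologicalSpace X]
    [SecondCountableTopology X] {Y : Type v} [MeasurableSpace Y] (μ : Measure Y) (f : X → Y)
    (s : Set X) (h : ∀ x ∈ s, ∃ V ∈ 𝓝 x, μ (f '' (s ∩ V)) = 0) : μ (f '' s) = 0 := by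
  classical
  choose! V hV hμV using h
  obtain ⟨t, hts, htc, hcover⟩ := TopologicalSpace.countable_cover_nhdsWithin (f := V) (s := s)
    (fun x hx => mem_nhdsWithin_of_mem_nhds (hV x hx))
  have hsub : f '' s ⊆ ⋃ x ∈ t, f '' (s ∩ V x) := by
    rintro _ ⟨y, hy, rfl⟩
    obtain ⟨x, hxt, hyx⟩ : ∃ x ∈ t, y ∈ V x := by
      simpa only [mem_iUnion, exists_prop] using hcover hy
    exact mem_biUnion hxt (mem_image_of_mem f ⟨hy, hyx⟩)
  refine measure_mono_null hsub ?_
  exact (measure_biUnion_null_iff htc).2 fun x hx => hμV x (hts hx)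

/-- Null sets for one additive Haar measure are null for the image under a continuous linear
isomorphism with respect to any additive Haar measure on the target: if `ν (Φ '' T) = 0` then
`μ T = 0`. [folklore] -/
theorem addHaar_null_of_image_equiv_null {F : Type u} [NormedAddCommGroup F] [NormedSpace ℝ F]
    [FiniteDimensional ℝ F] [MeasurableSpace F] [BorelSpace F] {G : Type v} [NormedAddCommGroup G]
    [NormedSpace ℝ G] [FiniteDimensional ℝ G] [MeasurableSpace G] [BorelSpace G]
    (Φ : F ≃L[ℝ] G) (μ : Measure F) [μ.IsAddHaarMeasure] (ν : Measure G) [ν.IsAddHaarMeasure]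
    {T : Set F} (h : ν (Φ '' T) = 0) : μ T = 0 := by
  have hac : μ.map Φ ≪ ν := Measure.absolutelyContinuous_isAddHaarMeasure _ _
  have h1 : μ.map Φ (Φ '' T) = 0 := hac h
  have h2 : μ (Φ ⁻¹' (Φ '' T)) ≤ μ.map Φ (Φ '' T) :=
    Measure.le_map_apply Φ.continuous.measurable.aemeasurable _
  rw [Φ.injective.preimage_image T, h1] at h2
  exact nonpos_iff_eq_zero.1 h2

/-! ### Straightening one smooth coordinate (inverse function theorem) -/

/-- **Local chart straightening a smooth function.** Let `w : E → ℝ` be `C^∞` on an open set `U` of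
a finite-dimensional space, `x₀ ∈ U`, and suppose `dw(x₀) = ℓ ≠ 0`; let `Φ : E ≃L ℝ × ker ℓ` have
first component `ℓ`. Then `h x = (w x, (Φ x).2)` restricts to a smooth local diffeomorphism `e`
around `x₀` with source inside `U` and `C^∞` inverse on its (open) target — the change of
variables of Sard (1942), §3 / Milnor (1965), §3, Step 1, making `w` the first coordinate.
[cite: MilnorTDV1965, §3, Step 1 (p. 17)] -/
theorem exists_chart_fst_eq {E : Type u} [NormedAddCommGroup E] [NormedSpace ℝ E]
    [FiniteDimensional ℝ E] {ℓ : E →L[ℝ] ℝ} (Φ : E ≃L[ℝ] ℝ × ℓ.ker) (hΦ : ∀ x, (Φ x).1 = ℓ x)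
    {w : E → ℝ} {U : Set E} (hU : IsOpen U) (hw : ContDiffOn ℝ ∞ w U) {x₀ : E} (hx₀ : x₀ ∈ U)
    (hℓ : fderiv ℝ w x₀ = ℓ) :
    ∃ e : OpenPartialHomeomorph E (ℝ × ℓ.ker), x₀ ∈ e.source ∧ e.source ⊆ U ∧
      (∀ x, e x = (w x, (Φ x).2)) ∧ ContDiffOn ℝ ∞ e.symm e.target := by
  haveI : CompleteSpace E := FiniteDimensional.complete ℝ E
  set h : E → ℝ × ℓ.ker := fun x => (w x, (Φ x).2) with h_def
  have hΦ2 : ContDiff ℝ ∞ fun x : E => (Φ x).2 := contDiff_snd.comp Φ.contDiff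
  have hh : ContDiffOn ℝ ∞ h U := hw.prodMk hΦ2.contDiffOn
  -- the derivative of `h` at `x₀` is `Φ`
  have hdw : HasFDerivAt w ℓ x₀ := by
    have hd : DifferentiableAt ℝ w x₀ :=
      (hw.differentiableOn (by simp) x₀ hx₀).differentiableAt (hU.mem_nhds hx₀)
    exact hℓ ▸ hd.hasFDerivAt
  have hd₀ : HasFDerivAt h (Φ : E →L[ℝ] ℝ × ℓ.ker) x₀ := by
    have h2 : HasFDerivAt (fun x : E => (Φ x).2)
        ((ContinuousLinearMap.snd ℝ ℝ ℓ.ker).comp (Φ : E →L[ℝ] ℝ × ℓ.ker)) x₀ :=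
      (Φ : E →L[ℝ] ℝ × ℓ.ker).hasFDerivAt.snd
    have h12 := hdw.prodMk h2
    have heq : ℓ.prod ((ContinuousLinearMap.snd ℝ ℝ ℓ.ker).comp (Φ : E →L[ℝ] ℝ × ℓ.ker)) =
        (Φ : E →L[ℝ] ℝ × ℓ.ker) := by
      ext x
      · simp [hΦ x]
      · simp
    rwa [heq] at h12
  -- the open set where the derivative of `h` is invertible
  set U₁ : Set E := U ∩ fderiv ℝ h ⁻¹' (Set.range ((↑) : (E ≃L[ℝ] ℝ × ℓ.ker) → E →L[ℝ] ℝ × ℓ.ker))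
    with hU₁_def
  have hU₁ : IsOpen U₁ :=
    (hh.continuousOn_fderiv_of_isOpen hU (by simp)).isOpen_inter_preimage hU
      ContinuousLinearEquiv.isOpen
  have hx₀U₁ : x₀ ∈ U₁ := ⟨hx₀, ⟨Φ, hd₀.fderiv.symm⟩⟩
  have hcd : ContDiffAt ℝ ∞ h x₀ := hh.contDiffAt (hU.mem_nhds hx₀)
  let e₀ := hcd.toOpenPartialHomeomorph h hd₀ (by simp)
  let e := e₀.restrOpen U₁ hU₁
  have hsource : e.source = e₀.source ∩ U₁ := e₀.restrOpen_source U₁ hU₁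
  refine ⟨e, ?_, ?_, fun x => rfl, ?_⟩
  · rw [hsource]
    exact ⟨hcd.mem_toOpenPartialHomeomorph_source hd₀ (by simp), hx₀U₁⟩
  · rw [hsource]
    exact fun x hx => hx.2.1
  · intro a ha
    have hxa : e.symm a ∈ U₁ := by
      have := e.map_target ha
      rw [hsource] at this
      exact this.2
    obtain ⟨T, hT⟩ := hxa.2
    have hdiff : HasFDerivAt h (T : E →L[ℝ] ℝ × ℓ.ker) (e.symm a) := by
      rw [hT]
      exact ((hh.differentiableOn (by simp) _ hxa.1).differentiableAt
        (hU.mem_nhds hxa.1)).hasFDerivAt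
    exact (e.contDiffAt_symm ha hdiff (hh.contDiffAt (hU.mem_nhds hxa.1))).contDiffWithinAt

/-! ### Flat Taylor estimate -/

/-- **Flat Taylor estimate.** If `f` is `C^∞` on an open set `U ∋ x` and all derivatives of `f` of
orders `1, …, k` vanish at `x` (`k ≥ 1`), then `‖f y - f x‖ ≤ c ‖y - x‖ ^ k` for `y` near `x`, for
every `c > 0` (Taylor's formula; proved by induction on `k` from the mean value inequality, whence
`E` and `G` live in a common universe). [folklore] -/
theorem eventually_norm_sub_le_mul_pow_of_iteratedFDeriv_eq_zero {E : Type u}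
    [NormedAddCommGroup E] [NormedSpace ℝ E] {G : Type u} [NormedAddCommGroup G]
    [NormedSpace ℝ G] {f : E → G} {U : Set E} (hU : IsOpen U) (hf : ContDiffOn ℝ ∞ f U) {x : E}
    (hx : x ∈ U) {k : ℕ} (hk : 1 ≤ k)
    (h0 : ∀ j, 1 ≤ j → j ≤ k → iteratedFDeriv ℝ j f x = 0) {c : ℝ} (hc : 0 < c) :
    ∀ᶠ y in 𝓝 x, ‖f y - f x‖ ≤ c * ‖y - x‖ ^ k := by
  induction k generalizing G f with
  | zero => exact absurd hk (by norm_num)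
  | succ k IH =>
    -- the derivative vanishes at `x`
    have hfd : fderiv ℝ f x = 0 := by
      have h1 := h0 1 le_rfl (by omega)
      rw [← norm_eq_zero, ← norm_iteratedFDeriv_one (𝕜 := ℝ) f, h1, norm_zero]
    have hdiff : ∀ y ∈ U, DifferentiableAt ℝ f y := fun y hy =>
      (hf.differentiableOn (by simp) y hy).differentiableAt (hU.mem_nhds hy)
    rcases Nat.eq_zero_or_pos k with rfl | hkpos
    · -- `k + 1 = 1`: this is differentiability with zero derivative
      have hlo := ((hdiff x hx).hasFDerivAt).isLittleO
      rw [hfd] at hlo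
      have := hlo.def hc
      filter_upwards [this] with y hy
      simpa using hy
    · -- induction, applied to `fderiv ℝ f`
      have hg : ContDiffOn ℝ ∞ (fderiv ℝ f) U := hf.fderiv_of_isOpen hU (by simp)
      have hg0 : ∀ j, 1 ≤ j → j ≤ k → iteratedFDeriv ℝ j (fderiv ℝ f) x = 0 := by
        intro j hj1 hjk
        rw [← norm_eq_zero, norm_iteratedFDeriv_fderiv, norm_eq_zero]
        exact h0 (j + 1) (by omega) (by omega)
      have hev := IH hg hkpos hg0
      simp only [hfd, sub_zero] at hev
      obtain ⟨δ, hδ, hball⟩ : ∃ δ > 0, ball x δ ⊆ {y | ‖fderiv ℝ f y‖ ≤ c * ‖y - x‖ ^ k} ∩ U :=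
        Metric.mem_nhds_iff.1 (Filter.inter_mem hev (hU.mem_nhds hx))
      filter_upwards [Metric.ball_mem_nhds x hδ] with y hy
      -- mean value inequality on the ball `closedBall x ‖y - x‖ ⊆ ball x δ`
      have hsub : closedBall x ‖y - x‖ ⊆ ball x δ := by
        refine closedBall_subset_ball ?_
        rwa [mem_ball_iff_norm] at hy
      have hbound : ∀ z ∈ closedBall x ‖y - x‖, ‖fderiv ℝ f z‖ ≤ c * ‖y - x‖ ^ k := by
        intro z hz
        have hz' := (hball (hsub hz)).1
        simp only [mem_setOf_eq] at hz'
        refine hz'.trans ?_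
        rw [mem_closedBall_iff_norm] at hz
        gcongr
      have hmv := (convex_closedBall x ‖y - x‖).norm_image_sub_le_of_norm_fderiv_le
        (fun z hz => hdiff z (hball (hsub hz)).2) hbound
        (mem_closedBall_self (norm_nonneg _)) (mem_closedBall_iff_norm.2 le_rfl)
      calc ‖f y - f x‖ ≤ c * ‖y - x‖ ^ k * ‖y - x‖ := hmv
        _ = c * ‖y - x‖ ^ (k + 1) := by ring

end Literature.Analysis.Calculus.Sard
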